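import Mathlib.ModelTheory.Complexity
import Mathlib.ModelTheory.Equivalence
import HarnessLib

/-!
# Existential and universal formulas: closure under the connectives, up to equivalence

Syntactic support for arguments with existential formulas (Robinson's test,
`Theory.isModelComplete_iff_forall_exists_isExistential` in
`Literature/ModelTheory/ExponentialFields/ModelTheoryPreds.lean`; the existential theory of a
structure, `Literature/ModelTheory/ExponentialFields/MacintyreWilkie.lean`). Mathlib's
`BoundedFormula.IsExistential` / `IsUniversal` are *syntactic* (a block of `∃`, resp. `∀`, in
front of a quantifier-free matrix), so a disjunction or conjunction of two existential formulas is
not existential; we prove that it is *equivalent* (modulo any theory `T`, `Theory.Iff`) to an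
existential formula, using Mathlib's prenexing operations `toPrenexImp`/`toPrenexImpRight`:

* `IsExistential.liftAt/castLE/isPrenex`, `IsUniversal.liftAt/castLE/isPrenex` [folklore];
* `isExistential_toPrenexImp`: `φ.toPrenexImp ψ` is existential for `φ` universal and `ψ`
  existential; `isUniversal_toPrenexImp`: universal for `φ` existential and `ψ` universal;
* `IsExistential.exists_isUniversal_iff_not`, `IsUniversal.exists_isExistential_iff_not`:
  negations swap the two classes up to `T`-equivalence;
* `IsExistential.exists_iff_sup`, `IsExistential.exists_iff_inf`, `IsExistential.exists_iff_foldr_sup`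
  (truth of the fold: Mathlib's `realize_foldr_sup`):
  closure of existential formulas under `⊔`, `⊓` and finite disjunctions up to `T`-equivalence
  (standard prenex manipulations, cf. Mathlib's `BoundedFormula.toPrenex`). [folklore]

All declarations are dot-notation extensions in Mathlib's namespace
`FirstOrder.Language.BoundedFormula` (no Mathlib declaration of these names exists).
-/

namespace FirstOrder.Language.BoundedFormula

open FirstOrder

variable {L : Language} {α : Type*} {l n : ℕ}

/-! ### Stability under `castLE` and `liftAt`; prenexity -/

/-- Existential formulas are stable under `castLE`. [folklore] -/
theorem IsExistential.castLE {φ : L.BoundedFormula α l} (hφ : IsExistential φ) :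
    ∀ {n} {h : l ≤ n}, (φ.castLE h).IsExistential :=
  IsExistential.recOn (motive := @fun l φ _ => ∀ (n : ℕ) (h : l ≤ n), (φ.castLE h).IsExistential)
    hφ (@fun _ _ ih _ _ => ih.castLE.isExistential) (@fun _ _ _ ih _ _ => (ih _ _).ex) _ _

/-- Existential formulas are stable under `liftAt`. [folklore] -/
theorem IsExistential.liftAt {φ : L.BoundedFormula α l} {k m : ℕ} (h : IsExistential φ) :
    (φ.liftAt k m).IsExistential :=
  IsExistential.recOn h (fun ih => ih.liftAt.isExistential) fun _ ih => ih.castLE.ex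

/-- Universal formulas are stable under `castLE`. [folklore] -/
theorem IsUniversal.castLE {φ : L.BoundedFormula α l} (hφ : IsUniversal φ) :
    ∀ {n} {h : l ≤ n}, (φ.castLE h).IsUniversal :=
  IsUniversal.recOn (motive := @fun l φ _ => ∀ (n : ℕ) (h : l ≤ n), (φ.castLE h).IsUniversal)
    hφ (@fun _ _ ih _ _ => ih.castLE.isUniversal) (@fun _ _ _ ih _ _ => (ih _ _).all) _ _

/-- Universal formulas are stable under `liftAt`. [folklore] -/
theorem IsUniversal.liftAt {φ : L.BoundedFormula α l} {k m : ℕ} (h : IsUniversal φ) :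
    (φ.liftAt k m).IsUniversal :=
  IsUniversal.recOn h (fun ih => ih.liftAt.isUniversal) fun _ ih => ih.castLE.all

/-- Existential formulas are prenex. [folklore] -/
theorem IsExistential.isPrenex {φ : L.BoundedFormula α n} (h : IsExistential φ) : IsPrenex φ :=
  IsExistential.recOn h (fun h => h.isPrenex) fun _ ih => ih.ex

/-- Universal formulas are prenex. [folklore] -/
theorem IsUniversal.isPrenex {φ : L.BoundedFormula α n} (h : IsUniversal φ) : IsPrenex φ :=
  IsUniversal.recOn h (fun h => h.isPrenex) fun _ ih => ih.all

/-! ### Prenexing an implication between a universal and an existential formula -/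

/-- `φ.toPrenexImpRight ψ` is existential for `φ` quantifier-free and `ψ` existential. [folklore] -/
theorem isExistential_toPrenexImpRight {φ ψ : L.BoundedFormula α n} (hφ : IsQF φ)
    (hψ : IsExistential ψ) : IsExistential (φ.toPrenexImpRight ψ) := by
  induction hψ with
  | of_isQF hψ => rw [hψ.toPrenexImpRight]; exact (hφ.imp hψ).isExistential
  | ex _ ih => exact (ih hφ.liftAt).ex

/-- `φ.toPrenexImpRight ψ` is universal for `φ` quantifier-free and `ψ` universal. [folklore] -/
theorem isUniversal_toPrenexImpRight {φ ψ : L.BoundedFormula α n} (hφ : IsQF φ)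
    (hψ : IsUniversal ψ) : IsUniversal (φ.toPrenexImpRight ψ) := by
  induction hψ with
  | of_isQF hψ => rw [hψ.toPrenexImpRight]; exact (hφ.imp hψ).isUniversal
  | all _ ih => exact (ih hφ.liftAt).all

/-- `φ.toPrenexImp ψ` is existential for `φ` universal and `ψ` existential
(`(∀ x φ) ⟹ ψ` prenexes to `∃ x (φ ⟹ ψ)`). [folklore] -/
theorem isExistential_toPrenexImp {φ ψ : L.BoundedFormula α n} (hφ : IsUniversal φ)
    (hψ : IsExistential ψ) : IsExistential (φ.toPrenexImp ψ) := by
  induction hφ with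
  | of_isQF hφ => rw [hφ.toPrenexImp]; exact isExistential_toPrenexImpRight hφ hψ
  | all _ ih => exact (ih hψ.liftAt).ex

/-- `φ.toPrenexImp ψ` is universal for `φ` existential and `ψ` universal
(`(∃ x φ) ⟹ ψ` prenexes to `∀ x (φ ⟹ ψ)`). [folklore] -/
theorem isUniversal_toPrenexImp {φ ψ : L.BoundedFormula α n} (hφ : IsExistential φ)
    (hψ : IsUniversal ψ) : IsUniversal (φ.toPrenexImp ψ) := by
  induction hφ with
  | of_isQF hφ => rw [hφ.toPrenexImp]; exact isUniversal_toPrenexImpRight hφ hψ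
  | ex _ ih => exact (ih hψ.liftAt).all

/-! ### Negation, disjunction and conjunction up to equivalence -/

variable {T : L.Theory}

/-- `φ.toPrenexImp ψ` is `T`-equivalent to `φ ⟹ ψ` for prenex `φ`, `ψ`
(Mathlib's `realize_toPrenexImp`, as a `Theory.Iff`). [folklore] -/
theorem iff_toPrenexImp {φ ψ : L.BoundedFormula α n} (hφ : IsPrenex φ) (hψ : IsPrenex ψ) :
    (φ.imp ψ) ⇔[T] φ.toPrenexImp ψ := fun M v xs => by
  rw [realize_iff, realize_toPrenexImp hφ hψ]

/-- The negation of an existential formula is `T`-equivalent to a universal formula. [folklore] -/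
theorem IsExistential.exists_isUniversal_iff_not {φ : L.BoundedFormula α n} (h : IsExistential φ) :
    ∃ υ : L.BoundedFormula α n, υ.IsUniversal ∧ (φ.not ⇔[T] υ) := by
  induction h with
  | of_isQF h => exact ⟨_, (h.imp IsQF.falsum).isUniversal, Theory.Iff.refl _⟩
  | ex _ ih =>
    rename_i ψ _
    obtain ⟨υ, hυ, hiff⟩ := ih
    refine ⟨υ.all, hυ.all, ?_⟩
    -- `(∃' ψ).not = ψ.not.all.not.not ⇔ ψ.not.all ⇔ υ.all`
    exact (iff_not_not ψ.not.all).symm.trans hiff.all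

/-- The negation of a universal formula is `T`-equivalent to an existential formula. [folklore] -/
theorem IsUniversal.exists_isExistential_iff_not {φ : L.BoundedFormula α n} (h : IsUniversal φ) :
    ∃ ε : L.BoundedFormula α n, ε.IsExistential ∧ (φ.not ⇔[T] ε) := by
  induction h with
  | of_isQF h => exact ⟨_, (h.imp IsQF.falsum).isExistential, Theory.Iff.refl _⟩
  | all _ ih =>
    rename_i ψ _
    obtain ⟨ε, hε, hiff⟩ := ih
    refine ⟨ε.ex, hε.ex, ?_⟩
    -- `(∀' ψ).not ⇔ (∀' ψ.not.not).not = ∃' ψ.not ⇔ ∃' ε`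
    exact ((iff_not_not ψ).all.not).trans hiff.ex

/-- **The disjunction of two existential formulas is `T`-equivalent to an existential formula.** [folklore] -/
theorem IsExistential.exists_iff_sup {φ ψ : L.BoundedFormula α n} (hφ : IsExistential φ)
    (hψ : IsExistential ψ) : ∃ ε : L.BoundedFormula α n, ε.IsExistential ∧ ((φ ⊔ ψ) ⇔[T] ε) := by
  obtain ⟨υ, hυ, h1⟩ := hφ.exists_isUniversal_iff_not (T := T)
  refine ⟨υ.toPrenexImp ψ, isExistential_toPrenexImp hυ hψ, ?_⟩
  show (φ.not.imp ψ) ⇔[T] υ.toPrenexImp ψ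
  exact (h1.imp (Theory.Iff.refl ψ)).trans (iff_toPrenexImp hυ.isPrenex hψ.isPrenex)

/-- **The conjunction of two existential formulas is `T`-equivalent to an existential formula.** [folklore] -/
theorem IsExistential.exists_iff_inf {φ ψ : L.BoundedFormula α n} (hφ : IsExistential φ)
    (hψ : IsExistential ψ) : ∃ ε : L.BoundedFormula α n, ε.IsExistential ∧ ((φ ⊓ ψ) ⇔[T] ε) := by
  -- `φ ⊓ ψ = (φ ⟹ ψ.not).not`; `ψ.not ⇔ υ` universal; `φ ⟹ υ` prenexes to a universal formula;
  -- its negation is equivalent to an existential one.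
  obtain ⟨υ, hυ, h1⟩ := hψ.exists_isUniversal_iff_not (T := T)
  have h2 : (φ.imp ψ.not) ⇔[T] φ.toPrenexImp υ :=
    ((Theory.Iff.refl φ).imp h1).trans (iff_toPrenexImp hφ.isPrenex hυ.isPrenex)
  obtain ⟨ε, hε, h3⟩ := (isUniversal_toPrenexImp hφ hυ).exists_isExistential_iff_not (T := T)
  exact ⟨ε, hε, show (φ.imp ψ.not).not ⇔[T] ε from h2.not.trans h3⟩

/-- `⊥` is existential. [folklore] -/
theorem isExistential_bot : (⊥ : L.BoundedFormula α n).IsExistential :=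
  IsQF.falsum.isExistential

/-- **A finite disjunction of existential formulas is `T`-equivalent to an existential formula.** [folklore] -/
theorem IsExistential.exists_iff_foldr_sup (s : List (L.BoundedFormula α n))
    (hs : ∀ φ ∈ s, φ.IsExistential) :
    ∃ ε : L.BoundedFormula α n, ε.IsExistential ∧ ((s.foldr (· ⊔ ·) ⊥) ⇔[T] ε) := by
  induction s with
  | nil => exact ⟨⊥, isExistential_bot, Theory.Iff.refl _⟩
  | cons φ s ih =>
    obtain ⟨ε, hε, hiff⟩ := ih fun χ hχ => hs χ (List.mem_cons_of_mem _ hχ)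
    obtain ⟨ε', hε', hiff'⟩ := (hs φ List.mem_cons_self).exists_iff_sup hε (T := T)
    refine ⟨ε', hε', ?_⟩
    rw [List.foldr_cons]
    -- `φ ⊔ rest ⇔ φ ⊔ ε ⇔ ε'`
    have h1 : (φ ⊔ s.foldr (· ⊔ ·) ⊥) ⇔[T] (φ ⊔ ε) :=
      show (φ.not.imp (s.foldr (· ⊔ ·) ⊥)) ⇔[T] (φ.not.imp ε) from (Theory.Iff.refl _).imp hiff
    exact h1.trans hiff'

end FirstOrder.Language.BoundedFormula
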